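import Summits.QuantumFields.QCD.Theses.GaussianLinkFrames
import Summits.QuantumFields.QCD.Theorems.MobilityGap.Negative.LowerPin

/-!
# Crux `FrameFMClosure` (stmt-QuantumFields-17375), negative side — the frame's mass window versus the core

Support file of the standing disprover (cdisprove seat, cycle 1) of crux #3 `FrameFMClosure` of route
`GaussianLinkFrames` (`Summit.QuantumFields.QCD.Theses.GaussianLinkFrames.FrameFMClosure`).  No
refutation is possible in Lean without PROVING the antecedent `FrameAPrioriBound` (crux #2, open):
`FrameFMClosure` is LITERALLY `FrameAPrioriBound → Core` (`frameFMClosure_iff`, `Iff.rfl`), with `Core`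
byte-identical to the core of `PauliWegnerSea.FMClosureUnquenched` (stmt-QuantumFields-11512), so every
finding of that crux's standing Disproof (`Cruxes/FMClosureUnquenched/Disproof.lean`: §2 decoration, §4
unit-shell corner, §5 inside the shell, §8 non-vacuity) transfers verbatim.  This file is theorem-only
(statements written out over the landed vocabulary `fm`, `bare`, `ClauseI`, `Upper` of
`Theorems/MobilityGap/Negative/LowerPin.lean`; the disprover's work file
`Cruxes/FrameFMClosure/Disproof.lean` has the same content with abbreviations `Input`, `CoreAt`, `Core`)
and records, sorry-free, what is SPECIFIC to #3: the relation between the antecedent's bare-mass window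
`m₀ ∈ [-2, 2]` and the trajectories the core quantifies over.  "Input" below always denotes the one-scale
hypothesis of the core, `∀ q ∃ K₀ s ∀ᶠ k ∃ ℓ₀ ∈ [1, L_k], ℓ₀ a_k ≤ K₀(1+|log a_k|),
ℓ₀^q (1+|β_k|)^q fm(shell ‖v‖∞ = ℓ₀, s) ≤ 1`, written out.

* `frameFMClosure_iff` — the definitional re-reading `FrameFMClosure ↔ (FrameAPrioriBound → core)`.
* `upper_of_eventually_heavy` — on every trajectory whose realised bare masses are eventually in the
  convergent hopping window `|m_f(k) + 4| ≥ 41/10` the CONCLUSION of the core (clause (ii) `Upper`,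
  physical-rate decay) holds outright, at every coupling sequence `β_k` (landed
  `ThickCollarFarStability.stub_hopping`).  So the content of #3 lives on the light window
  `m_f(k) ∈ (-81/10, 1/10)` only.
* `input_of_heavy_of_bddBeta` — on the same window, with `|β_k|` bounded, the one-scale Input holds too
  (one fixed shell `ℓ₀(q, β₀)`, `s = 1/2`, `K₀ = ℓ₀`): the hypotheses of the core are inhabited by heavy seas
  at any bounded coupling, not only at `β ≡ 0` (11512 Disproof §8).
* `window_dichotomy`, `eventually_frame_or_hopping_of_clauseI`, `light_doubler_side` — arithmetic: a bare
  mass `> -1` is either in the hopping window or in the frame window `[-2, 2]`.  Hence WITH clause (i) of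
  `MobilityGap` (`∀ f, ∀ᶠ k, -1 < m_f(k)`) every realised mass is eventually covered either by
  `stub_hopping` or by the `m₀`-range of `FrameAPrioriBound`; WITHOUT it (as #3 is typed) the light doubler
  side `(-81/10, -2)` is quantified over with a silent antecedent — there #3 is exactly 11512's core.
  (Refuter R0 of LEAD-1 §3: a restated #3 must carry clause (i); it is necessary AND sufficient for the
  antecedent to be instantiable at the realised masses wherever hopping does not already conclude.)
* `exists_input_above_frameWindow`, `exists_input_below_frameWindow` — the two heavy corners are
  INHABITED at any constant coupling: trajectories with Input and (i) whose masses stay `> 2`, and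
  trajectories with Input, `¬ (i)`, masses `< -2`; on both the antecedent is never instantiable at the
  realised masses, and on both `Upper` holds anyway (no counterexample to the core in the heavy corners).
* `frameFMClosure_iff_anyMass` — decoration (11512 Disproof §2, for this decl): `∀ f, 0 < m f` is idle, the
  unconstrained `mcrit` absorbs any real tuple (shifted regularisation built inline).
* `frameFMClosure_corner` — the unit-shell corner (11512 Disproof §4) for this decl: given #2, #3 contains the
  threshold-free nearest-neighbour criterion at `β ≡ 0` — where the Hubbard–Stratonovich tilts vanish and
  the antecedent is used at `B = 0` only.
* `frameFMClosure_diagonalBound` — the `v = 0` instance of the conclusion: #3 (given #2) asserts a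
  `k`-uniform (hence `β_k`-uniform) bound on the diagonal phase-quenched moment of EVERY trajectory with
  Input — coupling-uniform Wegner-type content, while `FrameAPrioriBound` offers `(1+B)^p` with tilt
  `B ≍ β` (rattack A7′ of the sibling crux, instantiated).
-/

noncomputable section

namespace Summit.QuantumFields.QCD.Theorems.FrameFMClosure.Negative

open scoped BigOperators Topology
open MeasureTheory Filter Set
open Literature.MathematicalPhysics.QuantumFieldTheory Literature.MathematicalPhysics.QuantumLattice
  Literature.Probability.LatticeModels
open Summit.QuantumFields.QCD.Theorems.MobilityGapNegative
open Summit.QuantumFields.QCD.Theses.GaussianLinkFrames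

variable {Nf : ℕ}

/-! ### §0 The crux re-read (definitional) -/

/-- #3 is LITERALLY `FrameAPrioriBound → core`, the core being 11512's: positive masses, one-scale input
`⇒` clause (ii) `Upper`, for EVERY regularisation. -/
theorem frameFMClosure_iff :
    FrameFMClosure ↔ (FrameAPrioriBound →
      ∀ (Nf : ℕ) (reg : QCDRegularisation Nf) (m : Fin Nf → ℝ), (∀ f, 0 < m f) →
        (∀ q : ℕ, ∃ K₀ s : ℝ, 0 < s ∧ s < 1 ∧ ∀ᶠ k in atTop, ∃ ℓ₀ : ℕ, 1 ≤ ℓ₀ ∧ ℓ₀ ≤ reg.L k ∧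
          (ℓ₀ : ℝ) * reg.a k ≤ K₀ * (1 + |Real.log (reg.a k)|) ∧
          ∀ S : ℕ, reg.L k ≤ S → ∀ (f : Fin _) (v : Site 4), v ∈ box 4 S → ‖v‖ = (ℓ₀ : ℝ) →
            (ℓ₀ : ℝ) ^ q * (1 + |reg.β k|) ^ q * fm _ (reg.β k) (bare reg m k) S f v s ≤ 1) →
        Upper reg m) :=
  Iff.rfl

/-! ### §1 The heavy corners: the conclusion holds outright, the input is inhabited -/

/-- Eventually `a_k ≤ 1` and `n ≤ L_k`, for every regularisation and every `n`. -/
theorem eventually_a_le_one_and_le_L (reg : QCDRegularisation Nf) (n : ℕ) :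
    ∀ᶠ k in atTop, reg.a k ≤ 1 ∧ n ≤ reg.L k := by
  have ha : ∀ᶠ k in atTop, reg.a k ≤ 1 :=
    (reg.tendsto_a.eventually (gt_mem_nhds one_pos)).mono fun k hk => hk.le
  have hL : ∀ᶠ k in atTop, (n : ℝ) ≤ reg.a k * reg.L k := reg.tendsto_L.eventually_ge_atTop n
  filter_upwards [ha, hL] with k hak hk
  refine ⟨hak, ?_⟩
  have h1 : reg.a k * reg.L k ≤ reg.L k := by
    have := mul_le_mul_of_nonneg_right hak (Nat.cast_nonneg (reg.L k) : (0 : ℝ) ≤ reg.L k)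
    simpa using this
  exact_mod_cast hk.trans h1

/-- **Conclusion on the heavy window.** If the realised bare masses are eventually all in the convergent
hopping window `|m_f(k) + 4| ≥ 41/10`, clause (ii) `Upper` holds — at every coupling sequence, with
`(s, δ, C) = (1/2, 1, 1440)` — by the landed hopping bound.  The core's content is on the light window. -/
theorem upper_of_eventually_heavy (reg : QCDRegularisation Nf) (m : Fin Nf → ℝ)
    (h : ∀ᶠ k in atTop, ∀ f : Fin Nf, (41 / 10 : ℝ) ≤ |bare reg m k f + 4|) : Upper reg m := by
  obtain ⟨C, μ, hC, hμ, hhop⟩ :=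
    Summit.QuantumFields.QCD.Theorems.ThickCollarFarStability.stub_hopping Nf
  refine ⟨1 / 2, 1, C, by norm_num, by norm_num, one_pos, ?_⟩
  have hsmall : ∀ᶠ k in atTop, reg.a k ≤ μ / 2 :=
    reg.tendsto_a.eventually (eventually_le_nhds (by positivity))
  filter_upwards [hsmall, h] with k hk hwin S _ f v hv
  have hb := hhop (reg.β k) (bare reg m k) f (hwin f) S (1 / 2) (by norm_num) (by norm_num) v hv
  refine hb.trans (mul_le_mul_of_nonneg_left (Real.exp_le_exp.2 ?_) hC)
  have hv0 : 0 ≤ ‖v‖ := norm_nonneg _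
  nlinarith

/-- Real analysis: `x^q e^{-c x} → 0` (`c > 0`). -/
theorem tendsto_pow_mul_exp_neg_mul (q : ℕ) {c : ℝ} (hc : 0 < c) :
    Tendsto (fun x : ℝ => x ^ q * Real.exp (-(c * x))) atTop (𝓝 0) := by
  have h1 : Tendsto (fun x : ℝ => (c * x) ^ q * Real.exp (-(c * x))) atTop (𝓝 0) :=
    (Real.tendsto_pow_mul_exp_neg_atTop_nhds_zero q).comp (tendsto_id.const_mul_atTop hc)
  have h2 := h1.const_mul ((c ^ q)⁻¹)
  rw [mul_zero] at h2
  refine h2.congr fun x => ?_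
  have hcq : c ^ q ≠ 0 := pow_ne_zero _ hc.ne'
  rw [mul_pow]
  field_simp

/-- **Input on the heavy window (bounded coupling).** If `|β_k| ≤ β₀` and ALL realised bare masses are in
the hopping window, the one-scale Input holds: for each `q` one fixed shell `ℓ₀(q, β₀)` with
`1440 ℓ₀^q (1+β₀)^q e^{-log(41/40) ℓ₀/2} ≤ 1`, `s = 1/2`, `K₀ = ℓ₀`. -/
theorem input_of_heavy_of_bddBeta (reg : QCDRegularisation Nf) (m : Fin Nf → ℝ) (β₀ : ℝ)
    (hβ : ∀ k, |reg.β k| ≤ β₀) (h : ∀ (k : ℕ) (f : Fin Nf), (41 / 10 : ℝ) ≤ |bare reg m k f + 4|) :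
    (∀ q : ℕ, ∃ K₀ s : ℝ, 0 < s ∧ s < 1 ∧ ∀ᶠ k in atTop, ∃ ℓ₀ : ℕ, 1 ≤ ℓ₀ ∧ ℓ₀ ≤ reg.L k ∧
      (ℓ₀ : ℝ) * reg.a k ≤ K₀ * (1 + |Real.log (reg.a k)|) ∧
      ∀ S : ℕ, reg.L k ≤ S → ∀ (f : Fin _) (v : Site 4), v ∈ box 4 S → ‖v‖ = (ℓ₀ : ℝ) →
        (ℓ₀ : ℝ) ^ q * (1 + |reg.β k|) ^ q * fm _ (reg.β k) (bare reg m k) S f v s ≤ 1) := by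
  obtain ⟨C, μ, hC, hμ, hhop⟩ :=
    Summit.QuantumFields.QCD.Theorems.ThickCollarFarStability.stub_hopping Nf
  have hβ₀ : 0 ≤ β₀ := (abs_nonneg _).trans (hβ 0)
  intro q
  -- the shell radius: a natural number ℓ ≥ 1 with ℓ^q (1+β₀)^q C e^{-μ ℓ / 2} ≤ 1
  have hlim : Tendsto (fun x : ℝ => (1 + β₀) ^ q * C * (x ^ q * Real.exp (-(μ / 2 * x)))) atTop (𝓝 0) := by
    have := (tendsto_pow_mul_exp_neg_mul q (c := μ / 2) (by positivity)).const_mul ((1 + β₀) ^ q * C)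
    rwa [mul_zero] at this
  have hev : ∀ᶠ n : ℕ in atTop, (1 + β₀) ^ q * C * ((n : ℝ) ^ q * Real.exp (-(μ / 2 * n))) ≤ 1 :=
    (hlim.comp tendsto_natCast_atTop_atTop).eventually (eventually_le_nhds one_pos)
  obtain ⟨ℓ, hℓ, hℓ1⟩ := (hev.and (eventually_ge_atTop 1)).exists
  refine ⟨ℓ, 1 / 2, by norm_num, by norm_num, ?_⟩
  filter_upwards [eventually_a_le_one_and_le_L reg ℓ] with k hk
  refine ⟨ℓ, hℓ1, hk.2, ?_, ?_⟩
  · -- ℓ a_k ≤ ℓ (1 + |log a_k|)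
    have h0 : 0 ≤ |Real.log (reg.a k)| := abs_nonneg _
    have hℓ0 : (0 : ℝ) ≤ ℓ := Nat.cast_nonneg ℓ
    nlinarith [hk.1]
  · intro S _ f v hv hnorm
    have hb := hhop (reg.β k) (bare reg m k) f (h k f) S (1 / 2) (by norm_num) (by norm_num) v hv
    rw [hnorm] at hb
    have hroom : (0 : ℝ) ≤ (ℓ : ℝ) ^ q * (1 + |reg.β k|) ^ q := by positivity
    have hβk : (1 + |reg.β k|) ^ q ≤ (1 + β₀) ^ q :=
      pow_le_pow_left₀ (by positivity) (by linarith [hβ k]) q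
    calc (ℓ : ℝ) ^ q * (1 + |reg.β k|) ^ q * fm Nf (reg.β k) (bare reg m k) S f v (1 / 2)
        ≤ (ℓ : ℝ) ^ q * (1 + |reg.β k|) ^ q * (C * Real.exp (-(μ * (1 / 2) * ℓ))) :=
          mul_le_mul_of_nonneg_left hb hroom
      _ ≤ (ℓ : ℝ) ^ q * (1 + β₀) ^ q * (C * Real.exp (-(μ * (1 / 2) * ℓ))) := by
          apply mul_le_mul_of_nonneg_right _ (by positivity)
          exact mul_le_mul_of_nonneg_left hβk (by positivity)
      _ = (1 + β₀) ^ q * C * ((ℓ : ℝ) ^ q * Real.exp (-(μ / 2 * ℓ))) := by ring_nf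
      _ ≤ 1 := hℓ

/-! ### §2 The frame window `[-2, 2]` of the antecedent versus clause (i) -/

/-- **Window dichotomy.** A bare mass on the physical branch `M > -1` is either in the convergent hopping
window `|M + 4| ≥ 41/10` or in the `m₀`-range `[-2, 2]` of `FrameAPrioriBound`. -/
theorem window_dichotomy {M : ℝ} (h : -1 < M) : (41 / 10 : ℝ) ≤ |M + 4| ∨ (-2 ≤ M ∧ M ≤ 2) := by
  by_cases hM : 1 / 10 ≤ M
  · left
    rw [abs_of_pos (by linarith)]
    linarith
  · right
    push Not at hM
    constructor <;> linarith

/-- With clause (i) every realised bare mass is EVENTUALLY covered: by the hopping bound or by the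
antecedent's mass range. -/
theorem eventually_frame_or_hopping_of_clauseI (reg : QCDRegularisation Nf) (m : Fin Nf → ℝ)
    (h : ClauseI reg m) (f : Fin Nf) :
    ∀ᶠ k in atTop, (41 / 10 : ℝ) ≤ |bare reg m k f + 4| ∨ (-2 ≤ bare reg m k f ∧ bare reg m k f ≤ 2) :=
  (h f).mono fun _ hk => window_dichotomy hk

/-- Without clause (i) there is a LIGHT region outside both: the doubler side `(-81/10, -2)` (e.g. `M = -3`)
is neither in the hopping window nor in the frame window.  #3 as typed quantifies over trajectories living
there, where its antecedent is silent and no landed bound concludes. -/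
theorem light_doubler_side :
    ∃ M : ℝ, ¬ ((41 / 10 : ℝ) ≤ |M + 4|) ∧ ¬ (-2 ≤ M ∧ M ≤ 2) :=
  ⟨-3, by norm_num [abs_of_pos], by norm_num⟩

/-! ### §3 The heavy corners are inhabited (witness trajectories outside the frame window)

The witnesses are constant-parameter seas, built inline: `a_k = 1/(k+1)`, `L_k = (k+1)²`, `β ≡ β₀`,
`m_crit ≡ M`, `Z_m ≡ 1`, `m ≡ 1`, so the realised bare masses are `M + 1/(k+1) ∈ (M, M+1]`. -/

/-- `a_k L_k = k + 1 → ∞` for `a_k = 1/(k+1)`, `L_k = (k+1)²`. -/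
theorem tendsto_inv_succ_mul_sq :
    Tendsto (fun k : ℕ => (1 : ℝ) / ((k : ℝ) + 1) * (((k + 1) ^ 2 : ℕ) : ℝ)) atTop atTop := by
  have : (fun k : ℕ => (1 : ℝ) / ((k : ℝ) + 1) * (((k + 1) ^ 2 : ℕ) : ℝ)) = fun k : ℕ => (k : ℝ) + 1 := by
    funext k
    push_cast
    have : (k : ℝ) + 1 ≠ 0 := by positivity
    field_simp
  rw [this]
  exact tendsto_atTop_add_const_right _ 1 tendsto_natCast_atTop_atTop

/-- `1/(k+1) ∈ (0, 1]`. -/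
theorem inv_succ_pos_le_one (k : ℕ) : (0 : ℝ) < 1 / ((k : ℝ) + 1) ∧ 1 / ((k : ℝ) + 1) ≤ 1 := by
  refine ⟨by positivity, ?_⟩
  rw [div_le_one (by positivity)]
  linarith [(Nat.cast_nonneg k : (0 : ℝ) ≤ k)]

/-- **Above the window.** A one-flavour trajectory with positive mass, constant coupling `β₀`, clause (i),
the one-scale Input and clause (ii), whose bare masses stay `> 2` for ever: the antecedent
`FrameAPrioriBound` (`m₀ ∈ [-2,2]`) is never instantiable along it (and is not needed: `Upper` holds by
hopping). -/
theorem exists_input_above_frameWindow (β₀ : ℝ) :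
    ∃ (reg : QCDRegularisation 1) (m : Fin 1 → ℝ), (∀ f, 0 < m f) ∧ (∀ k, reg.β k = β₀) ∧
      ClauseI reg m ∧
      (∀ q : ℕ, ∃ K₀ s : ℝ, 0 < s ∧ s < 1 ∧ ∀ᶠ k in atTop, ∃ ℓ₀ : ℕ, 1 ≤ ℓ₀ ∧ ℓ₀ ≤ reg.L k ∧
        (ℓ₀ : ℝ) * reg.a k ≤ K₀ * (1 + |Real.log (reg.a k)|) ∧
        ∀ S : ℕ, reg.L k ≤ S → ∀ (f : Fin _) (v : Site 4), v ∈ box 4 S → ‖v‖ = (ℓ₀ : ℝ) →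
          (ℓ₀ : ℝ) ^ q * (1 + |reg.β k|) ^ q * fm _ (reg.β k) (bare reg m k) S f v s ≤ 1) ∧
      Upper reg m ∧ ∀ (k : ℕ) (f : Fin 1), 2 < bare reg m k f := by
  let reg : QCDRegularisation 1 :=
    { a := fun k => 1 / ((k : ℝ) + 1)
      a_pos := fun k => by positivity
      tendsto_a := tendsto_one_div_add_atTop_nhds_zero_nat
      β := fun _ => β₀
      L := fun k => (k + 1) ^ 2
      tendsto_L := tendsto_inv_succ_mul_sq
      mcrit := fun _ => 3
      Zm := fun _ => 1
      Zm_pos := fun _ => one_pos }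
  have hbare : ∀ (k : ℕ) (f : Fin 1), bare reg (fun _ => 1) k f = 3 + 1 / ((k : ℝ) + 1) := by
    intro k f
    simp [bare, reg]
  have hwin : ∀ (k : ℕ) (f : Fin 1), (41 / 10 : ℝ) ≤ |bare reg (fun _ => 1) k f + 4| := by
    intro k f
    rw [hbare, abs_of_pos (by positivity)]
    linarith [(inv_succ_pos_le_one k).1]
  refine ⟨reg, fun _ => 1, fun _ => one_pos, fun _ => rfl, ?_, ?_, ?_, ?_⟩
  · intro f
    refine Eventually.of_forall fun k => ?_
    have := hbare k f
    simp only [bare] at this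
    rw [this]
    linarith [(inv_succ_pos_le_one k).1]
  · exact input_of_heavy_of_bddBeta reg _ |β₀| (fun _ => le_rfl) hwin
  · exact upper_of_eventually_heavy reg _ (Eventually.of_forall fun k f => hwin k f)
  · intro k f
    rw [hbare]
    linarith [(inv_succ_pos_le_one k).1]

/-- **Below the window (doubler side).** A one-flavour trajectory with positive mass, constant coupling and the
one-scale Input whose bare masses stay `< -2` for ever, violating clause (i): as typed, #3 quantifies over it
with a silent antecedent.  (It is lattice-heavy, `m_f(k) ≤ -9`, so `Upper` holds by hopping — no
counterexample; the uncertifiable part of the doubler side is the LIGHT stretch `(-81/10, -2)`.) -/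
theorem exists_input_below_frameWindow (β₀ : ℝ) :
    ∃ (reg : QCDRegularisation 1) (m : Fin 1 → ℝ), (∀ f, 0 < m f) ∧ (∀ k, reg.β k = β₀) ∧
      ¬ ClauseI reg m ∧
      (∀ q : ℕ, ∃ K₀ s : ℝ, 0 < s ∧ s < 1 ∧ ∀ᶠ k in atTop, ∃ ℓ₀ : ℕ, 1 ≤ ℓ₀ ∧ ℓ₀ ≤ reg.L k ∧
        (ℓ₀ : ℝ) * reg.a k ≤ K₀ * (1 + |Real.log (reg.a k)|) ∧
        ∀ S : ℕ, reg.L k ≤ S → ∀ (f : Fin _) (v : Site 4), v ∈ box 4 S → ‖v‖ = (ℓ₀ : ℝ) →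
          (ℓ₀ : ℝ) ^ q * (1 + |reg.β k|) ^ q * fm _ (reg.β k) (bare reg m k) S f v s ≤ 1) ∧
      Upper reg m ∧ ∀ (k : ℕ) (f : Fin 1), bare reg m k f < -2 := by
  let reg : QCDRegularisation 1 :=
    { a := fun k => 1 / ((k : ℝ) + 1)
      a_pos := fun k => by positivity
      tendsto_a := tendsto_one_div_add_atTop_nhds_zero_nat
      β := fun _ => β₀
      L := fun k => (k + 1) ^ 2
      tendsto_L := tendsto_inv_succ_mul_sq
      mcrit := fun _ => -10
      Zm := fun _ => 1
      Zm_pos := fun _ => one_pos }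
  have hbare : ∀ (k : ℕ) (f : Fin 1), bare reg (fun _ => 1) k f = -10 + 1 / ((k : ℝ) + 1) := by
    intro k f
    simp [bare, reg]
  have hwin : ∀ (k : ℕ) (f : Fin 1), (41 / 10 : ℝ) ≤ |bare reg (fun _ => 1) k f + 4| := by
    intro k f
    rw [hbare, abs_of_neg (by linarith [(inv_succ_pos_le_one k).2])]
    linarith [(inv_succ_pos_le_one k).2]
  refine ⟨reg, fun _ => 1, fun _ => one_pos, fun _ => rfl, ?_, ?_, ?_, ?_⟩
  · intro h
    obtain ⟨k, hk⟩ := (h 0).exists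
    have := hbare k 0
    simp only [bare] at this
    rw [this] at hk
    linarith [(inv_succ_pos_le_one k).2]
  · exact input_of_heavy_of_bddBeta reg _ |β₀| (fun _ => le_rfl) hwin
  · exact upper_of_eventually_heavy reg _ (Eventually.of_forall fun k f => hwin k f)
  · intro k f
    rw [hbare]
    linarith [(inv_succ_pos_le_one k).2]

/-! ### §4 Decoration: positivity of the renormalised masses is idle (11512 Disproof §2, for this decl) -/

/-- **Decoration.** #3 with the hypothesis `∀ f, 0 < m f` DROPPED is the same statement: any real tuple `m`
is realised by the positive tuple `m + c`, `c = 1 + Σ|m_f|`, along the regularisation with the shifted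
(unconstrained) critical mass `mcrit k - a_k c / Zm k`, which has the same `a`, `β`, `L`, `Zm` and the same
realised bare masses. -/
theorem frameFMClosure_iff_anyMass :
    FrameFMClosure ↔ (FrameAPrioriBound →
      ∀ (Nf : ℕ) (reg : QCDRegularisation Nf) (m : Fin Nf → ℝ),
        (∀ q : ℕ, ∃ K₀ s : ℝ, 0 < s ∧ s < 1 ∧ ∀ᶠ k in atTop, ∃ ℓ₀ : ℕ, 1 ≤ ℓ₀ ∧ ℓ₀ ≤ reg.L k ∧
          (ℓ₀ : ℝ) * reg.a k ≤ K₀ * (1 + |Real.log (reg.a k)|) ∧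
          ∀ S : ℕ, reg.L k ≤ S → ∀ (f : Fin _) (v : Site 4), v ∈ box 4 S → ‖v‖ = (ℓ₀ : ℝ) →
            (ℓ₀ : ℝ) ^ q * (1 + |reg.β k|) ^ q * fm _ (reg.β k) (bare reg m k) S f v s ≤ 1) →
        Upper reg m) := by
  rw [frameFMClosure_iff]
  refine imp_congr_right fun _ => ⟨fun h Nf reg m hin => ?_, fun h Nf reg m _ hin => h Nf reg m hin⟩
  -- shift the critical mass
  set c : ℝ := 1 + ∑ f, |m f| with hc
  let reg' : QCDRegularisation Nf :=
    { a := reg.a, a_pos := reg.a_pos, tendsto_a := reg.tendsto_a, β := reg.β, L := reg.L,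
      tendsto_L := reg.tendsto_L, mcrit := fun k => reg.mcrit k - reg.a k * c / reg.Zm k,
      Zm := reg.Zm, Zm_pos := reg.Zm_pos }
  have hbare : ∀ k, bare reg' (fun fl => m fl + c) k = bare reg m k := by
    intro k
    funext fl
    have hZ : reg.Zm k ≠ 0 := (reg.Zm_pos k).ne'
    simp only [bare, reg']
    field_simp
    ring
  have hpos : ∀ f, 0 < m f + c := by
    intro f
    have h1 : |m f| ≤ ∑ g, |m g| :=
      Finset.single_le_sum (f := fun g => |m g|) (fun _ _ => abs_nonneg _) (Finset.mem_univ f)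
    have h2 : -|m f| ≤ m f := neg_abs_le _
    rw [hc]; linarith
  have key := h Nf reg' (fun fl => m fl + c) hpos (by simpa only [hbare] using hin)
  simpa only [Upper, hbare] using key

/-! ### §5 The unit-shell corner and the diagonal instance, for this decl -/

/-- **Soft corner (A5).** Given #2, #3 contains the THRESHOLD-FREE NEAREST-NEIGHBOUR CRITERION: at `β ≡ 0`
(where the Hubbard–Stratonovich tilts vanish, the conditional link law is Haar and the antecedent is used at
`B = 0` only), for every `N_f` and every bare-mass sequence, a volume-uniform bound `≤ 1` on the
phase-quenched moment at the 80 sup-norm neighbours of the origin implies physical-rate decay (Input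
witnessed by `ℓ₀ = 1`, `K₀ = 1`: room factor `1^q · 1^q = 1`). -/
theorem frameFMClosure_corner (h : FrameFMClosure) (hA : FrameAPrioriBound)
    (Nf : ℕ) (reg : QCDRegularisation Nf) (hβ : ∀ k, reg.β k = 0) (m : Fin Nf → ℝ) (hm : ∀ f, 0 < m f)
    (hnn : ∃ s : ℝ, 0 < s ∧ s < 1 ∧ ∀ᶠ k in atTop, ∀ S : ℕ, reg.L k ≤ S →
      ∀ (f : Fin Nf) (v : Site 4), v ∈ box 4 S → ‖v‖ = 1 → fm Nf (reg.β k) (bare reg m k) S f v s ≤ 1) :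
    Upper reg m := by
  obtain ⟨s, hs0, hs1, hev⟩ := hnn
  refine frameFMClosure_iff.1 h hA Nf reg m hm fun q => ⟨1, s, hs0, hs1, ?_⟩
  filter_upwards [hev, eventually_a_le_one_and_le_L reg 1] with k hk hk'
  refine ⟨1, le_rfl, hk'.2, ?_, ?_⟩
  · have : 0 ≤ |Real.log (reg.a k)| := abs_nonneg _
    push_cast
    nlinarith [hk'.1]
  · intro S hS f v hv hnorm
    have := hk S hS f v hv (by simpa using hnorm)
    simpa [hβ k] using this

/-- `0 ∈ box 4 S`. -/
theorem zero_mem_box (S : ℕ) : (0 : Site 4) ∈ box 4 S := by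
  rw [mem_box]; intro i; simp

/-- **Diagonal instance (A7′).** Given #2, #3 asserts for EVERY trajectory with the one-scale Input —
whatever its coupling sequence `β_k` — a `k`-uniform bound on the diagonal phase-quenched moment
`fm(·, 0, s) ≤ C` on all tori `S ≥ L_k`. -/
theorem frameFMClosure_diagonalBound (h : FrameFMClosure) (hA : FrameAPrioriBound)
    (Nf : ℕ) (reg : QCDRegularisation Nf) (m : Fin Nf → ℝ) (hm : ∀ f, 0 < m f)
    (hin : (∀ q : ℕ, ∃ K₀ s : ℝ, 0 < s ∧ s < 1 ∧ ∀ᶠ k in atTop, ∃ ℓ₀ : ℕ, 1 ≤ ℓ₀ ∧ ℓ₀ ≤ reg.L k ∧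
             (ℓ₀ : ℝ) * reg.a k ≤ K₀ * (1 + |Real.log (reg.a k)|) ∧
             ∀ S : ℕ, reg.L k ≤ S → ∀ (f : Fin _) (v : Site 4), v ∈ box 4 S → ‖v‖ = (ℓ₀ : ℝ) →
               (ℓ₀ : ℝ) ^ q * (1 + |reg.β k|) ^ q * fm _ (reg.β k) (bare reg m k) S f v s ≤ 1)) :
    ∃ s C : ℝ, 0 < s ∧ s < 1 ∧ ∀ᶠ k in atTop, ∀ S : ℕ, reg.L k ≤ S → ∀ f : Fin Nf,
      fm Nf (reg.β k) (bare reg m k) S f 0 s ≤ C := by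
  obtain ⟨s, δ, C, hs0, hs1, -, hev⟩ := frameFMClosure_iff.1 h hA Nf reg m hm hin
  refine ⟨s, C, hs0, hs1, hev.mono fun k hk S hS f => ?_⟩
  simpa using hk S hS f 0 (zero_mem_box S)

end Summit.QuantumFields.QCD.Theorems.FrameFMClosure.Negative

end
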